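import Summits.Ventures.GridStability.Models.DroopQVPortHamiltonianStrict
import Summits.Ventures.GridStability.Models.WSCC9DroopQVHessian

/-!
# GridStability/Models/WSCC9DroopQVHurwitz — the SHARP solver-free statement for the construction «DROOPQV-WSCC9»: every mode is the rotation zero mode or lies in the open left half-plane (one Gram certificate, no Lyapunov solve)

Cell `gridfusion` (LADDER-GRIDFUSION, APEX LINE rung G3.b; seat gridfusion-model-8 (g0)). Instance of the sharp family theorem
`DroopMicrogrid.re_eig_neg_or_rotation_of_hessQ` (`Models/DroopQVPortHamiltonianStrict.lean`) on `WSCC9.droopQV` with the positive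
definite certificate `WSCC9.droopQV_hessQ_add_rankOne_posDef` of `Models/WSCC9DroopQVHessian.lean` (p521952; one 9 × 9 integer Gram
certificate of `𝒬(θ*, V*) + r rᵀ`, 87-digit data) and the strict dissipation weights `k_P/τ_P² = 243/25 > 0`, `k_Q V*_i/τ_Q = 2V*_i/5 > 0`:
`WSCC9.droopQV_eig_re_neg_or_rotation` — every complex eigenpair `(μ, v)` of the `9 × 9` Jacobian at the rest point has `Re μ < 0`, or
`μ = 0` with `v` a multiple of `[1; 0; 0]`. Compared with the rider p521952 (`Re μ ≤ 0`) this EXCLUDES imaginary-axis modes; compared with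
the point row p520108 (`Re z < −51/50`) it carries no rate but needs no Lyapunov solve. THREE COLUMNS. CERTIFIED (kernel): matrix
statement about the MODEL `WSCC9.droopQV.toMicrogrid`. MODELLED: «MV-6D network version (KunduEtAl2019 (4a)–(4c), τ-filtered droop with
Q–V)» — SYNTHETIC/CONSTRUCTION (h12 couplings from model-4's Yred variant B; gains AS PRINTED §V; G = 0 lossless; no loads; set-points
DEFINED from (θ*, V*)). VALIDATED: nothing. No sentence of this file says a grid, a microgrid or a converter is stable.
-/

noncomputable section

open Real Matrix Finset
open scoped ComplexOrder

namespace Summit.Ventures.GridStability.Models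

namespace WSCC9

/-- **CERTIFIED, SOLVER-FREE, SHARP: Hurwitz on the rotation quotient for «DROOPQV-WSCC9».** Every complex eigenpair `(μ, v)` of
`jacMatrix (θ*, V*)` of `WSCC9.droopQV.toMicrogrid` has `Re μ < 0`, or `μ = 0` and `v` is a complex multiple of the rotation vector
`[1; 0; 0]`. Inputs: the family theorem of `DroopQVPortHamiltonianStrict` + the Gram certificate `𝒬 + r rᵀ ≻ 0` (p521952). CERTIFIED
(matrix statement); MODELLED: SYNTHETIC/CONSTRUCTION [cite: KunduEtAl2019, eqs. (4a)–(4c)] [cite: ShinZavala2020, Prop. 1]. No stability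
sentence. -/
theorem droopQV_eig_re_neg_or_rotation {μ : ℂ} {v : Fin 3 ⊕ (Fin 3 ⊕ Fin 3) → ℂ} (hv : v ≠ 0)
    (hJ : (droopQV.toMicrogrid.jacMatrix droopQV.angleOf droopQV.Vstar).map ((↑) : ℝ → ℂ) *ᵥ v = μ • v) :
    μ.re < 0 ∨ (μ = 0 ∧ ∃ a : ℂ, v = fun k => a * ((Sum.elim (fun _ => (1 : ℝ)) (Sum.elim 0 0) k : ℝ) : ℂ)) := by
  have hg := fun i => droopQV.toMicrogrid_gains i
  have hVq : ∀ i : Fin 3, 0 < droopQV.V i := by decide +kernel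
  refine droopQV.toMicrogrid.re_eig_neg_or_rotation_of_hessQ _ _ (fun i => ?_) (fun i => ?_) (fun i => ?_)
    (fun i => ?_) (fun i => ?_) (fun i => ?_) droopQV_hessQ_transpose droopQV_hessQ_add_rankOne_posDef hv hJ
  · rw [(hg i).2.2.1]; norm_num [droopQV]
  · rw [(hg i).1]; norm_num [droopQV]
  · rw [(hg i).2.2.2.1]; norm_num [droopQV]
  · change (droopQV.V i : ℝ) ≠ 0
    exact_mod_cast (hVq i).ne'
  · rw [(hg i).2.2.1, (hg i).1]; norm_num [droopQV]
  · rw [(hg i).2.2.2.1, (hg i).2.1]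
    have := hVq i
    simp only [DroopQVData.Vstar]
    norm_num [droopQV]
    positivity

end WSCC9

end Summit.Ventures.GridStability.Models

end
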